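import Summits.HodgeConjecture.HodgeConjecture.Theorems.R90S6TreeTypeSwapU2     -- ★ THE ENGINE (this seat): `exists_typeSwap_latticeTreeIso{,_of_datum}`; brings ★ `HermitianLatticeTree*`, ★ `R90S6ShellSphereDictU2`
import Literature.Combinatorics.SimpleGraph.TreeDescendantPartition            -- ★ `TreeLayers.dist_iso_apply` (graph isomorphisms are isometries)
import HarnessLib

/-!
# R90 · S6 — THE TYPE-SWAP TRANSPORTS ON `X₂`: `F_i(γ′) = F_{1−i}(γ)` and `S_i(γ′, n) = S_{1−i}(γ, n)` for `γ′ = gγg⁻¹`, `g` a scaling similitude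
# (`Theorems/R90S6TreeTypeSwapU2Transport.lean`; sequel of ★ `R90S6TreeTypeSwapU2`, split by the 400-line rule)

Cell `hodgecm-mathlib`, crux H413 (`stmt-HodgeConjecture-24833`), route of record `HCCMUnconditional`; programme R90-TF, section S6 (base `R90-C14`), seat
K2E3-p28 (g4); dealer R90-C14-plan (g2) RULING B′ (R90 bus 2026-09-05T02:26:05Z).  Helper lane `--supports stmt-HodgeConjecture-24833 --as helper`; THEOREMS ONLY.
CONSUMERS BY NAME: R90-C14-p02 (g2)'s LL1-COUNT `hswap : ∀ k, S₀(δ′,k) = S₁(δ,k)` (row E1.3.7.1, the Labesse–Langlands unstable count) and R90-C14-p03 (g3)'s HF1.2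
(`F₀(δ_ϖ)`, `N₀(δ_ϖ) = N₁(δ₁)`, `N₁(δ_ϖ) = N₀(δ₁)`; row E1.3.5.2.6 «D = 0»), both at the literal `δ_ϖ = diag(ϖ,1)·δ₁·diag(ϖ,1)⁻¹`.

THE MATHEMATICS ([LabesseLanglands1979] §§2–3; [Rogawski1990] §4.9, §12.6).  With the type-swapping automorphism `τ` of ★ `exists_typeSwap_latticeTreeIso` (`τ∘γ = γ′∘τ`,
`τ` an isometry ★ `TreeLayers.dist_iso_apply`), the typed displacement and fixed-point sets of `γ′` are the `τ`-images of the OPPOSITE-type sets of `γ`: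
* §1 generic reindexing along a semiconjugating graph automorphism (any graph, any predicates `Q (τ x) ↔ P x`);
* §2 the hermitian-plane transports in the PREDICATE currency (`IsSelfDualLattice` ∕ `IsModularLattice`, the set-builders of ★ H2-NUMBERS' `F₀` and `S_k`) and in the
  TYPE-FUNCTION currency (`c x = 0 ↔ x` self-dual; the set-builders of ★ H2-NUMBERS' `N_i`, ★ W8-f), for every `n` (not only `2k`);
* §3 the `U(1,1)` DATUM edition (`H = J₂`, `g = zpowDiagGL ![1, 0] = diag(ϖ,1)`, all letters discharged): the consumers' one-token forms.
HONEST LABEL: graph bookkeeping over ★ carriers; proves no printed global statement, discharges no citation; count-neutral helper until E1.3.7.1 ∕ E1.3.5.2.6 consume it.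
HC_CM is proved only modulo the 7 printed citations (2 remaining named inputs: hLiu418 = stmt-HodgeConjecture-24832, h413 = stmt-HodgeConjecture-24833) until rung 0 closes; REL ≠ ★ ≠ BUILT.

## References
* [LabesseLanglands1979] J.-P. Labesse, R. P. Langlands, *L-indistinguishability for SL(2)*, Canad. J. Math. 31 (1979): §§2–3.
* [Rogawski1990] J. D. Rogawski, *Automorphic Representations of Unitary Groups in Three Variables*, Ann. of Math. Stud. 123 (1990): §4.9 Lemma 4.9.3 pp. 54–56, §12.6.
* [Serre1980Trees] J.-P. Serre, *Trees* (1980): I.6.4, II.1.1.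
-/

set_option autoImplicit false
-- the mandated namespace repeats the single-problem summit's segment (`HodgeConjecture.HodgeConjecture`)
set_option linter.dupNamespace false

noncomputable section

open scoped ValuativeRel Matrix MatrixGroups
open Matrix ValuativeRel SimpleGraph
open Literature.NumberTheory.Automorphic Literature.NumberTheory.Automorphic.HermitianLatticeTree
open Literature.Combinatorics.SimpleGraph

namespace Summit.HodgeConjecture.HodgeConjecture.R90.S6

/-! ## §1 Reindexing a typed displacement ∕ fixed-point count along a semiconjugating graph automorphism -/

section Reindex

variable {V : Type*} {G : SimpleGraph V}

/-- **REINDEXING, displacement currency**: for graph automorphisms `τ α β` of `G` with `τ ∘ α = β ∘ τ` and predicates `P Q` with `Q (τ x) ↔ P x`, for every `n`: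
`#{y : d(y, βy) = n ∧ Q y} = #{x : d(x, αx) = n ∧ P x}` (the left set is `τ ''` the right one; `τ` is an isometry, ★ `TreeLayers.dist_iso_apply`). [cite: Serre1980Trees, II.1.1] -/
theorem ncard_setOf_dist_and_eq_of_semiconj (τ α β : G ≃g G) (hconj : ∀ x, τ (α x) = β (τ x)) (P Q : V → Prop) (hPQ : ∀ x, Q (τ x) ↔ P x) (n : ℕ) :
    {y | G.dist y (β y) = n ∧ Q y}.ncard = {x | G.dist x (α x) = n ∧ P x}.ncard := by
  have hset : {y | G.dist y (β y) = n ∧ Q y} = τ '' {x | G.dist x (α x) = n ∧ P x} := by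
    ext y
    simp only [Set.mem_setOf_eq, Set.mem_image]
    constructor
    · intro hy
      refine ⟨τ.symm y, ⟨?_, ?_⟩, τ.apply_symm_apply y⟩
      · rw [← TreeLayers.dist_iso_apply τ (τ.symm y) (α (τ.symm y)), hconj, RelIso.apply_symm_apply]
        exact hy.1
      · exact (hPQ (τ.symm y)).1 (by rw [RelIso.apply_symm_apply]; exact hy.2)
    · rintro ⟨x, hx, rfl⟩
      exact ⟨by rw [← hconj, TreeLayers.dist_iso_apply]; exact hx.1, (hPQ x).2 hx.2⟩
  rw [hset, Set.ncard_image_of_injective _ τ.injective]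

/-- **REINDEXING, displacement currency, predicate first**: `#{y : Q y ∧ d(y, βy) = n} = #{x : P x ∧ d(x, αx) = n}`. [cite: Serre1980Trees, II.1.1] -/
theorem ncard_setOf_and_dist_eq_of_semiconj (τ α β : G ≃g G) (hconj : ∀ x, τ (α x) = β (τ x)) (P Q : V → Prop) (hPQ : ∀ x, Q (τ x) ↔ P x) (n : ℕ) :
    {y | Q y ∧ G.dist y (β y) = n}.ncard = {x | P x ∧ G.dist x (α x) = n}.ncard := by
  have e1 : {y | Q y ∧ G.dist y (β y) = n} = {y | G.dist y (β y) = n ∧ Q y} := by ext y; exact and_comm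
  have e2 : {x | P x ∧ G.dist x (α x) = n} = {x | G.dist x (α x) = n ∧ P x} := by ext x; exact and_comm
  rw [e1, e2, ncard_setOf_dist_and_eq_of_semiconj τ α β hconj P Q hPQ n]

/-- **REINDEXING, fixed-point currency**: `#{y : βy = y ∧ Q y} = #{x : αx = x ∧ P x}`. [cite: Serre1980Trees, II.1.1] -/
theorem ncard_setOf_fixed_and_eq_of_semiconj (τ α β : G ≃g G) (hconj : ∀ x, τ (α x) = β (τ x)) (P Q : V → Prop) (hPQ : ∀ x, Q (τ x) ↔ P x) :
    {y | β y = y ∧ Q y}.ncard = {x | α x = x ∧ P x}.ncard := by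
  have hset : {y | β y = y ∧ Q y} = τ '' {x | α x = x ∧ P x} := by
    ext y
    simp only [Set.mem_setOf_eq, Set.mem_image]
    constructor
    · intro hy
      refine ⟨τ.symm y, ⟨?_, ?_⟩, τ.apply_symm_apply y⟩
      · apply τ.injective
        rw [hconj, RelIso.apply_symm_apply]
        exact hy.1
      · exact (hPQ (τ.symm y)).1 (by rw [RelIso.apply_symm_apply]; exact hy.2)
    · rintro ⟨x, hx, rfl⟩
      exact ⟨by rw [← hconj, hx.1], (hPQ x).2 hx.2⟩
  rw [hset, Set.ncard_image_of_injective _ τ.injective]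

/-- **REINDEXING, fixed-point currency, predicate first**: `#{y : Q y ∧ βy = y} = #{x : P x ∧ αx = x}`. [cite: Serre1980Trees, II.1.1] -/
theorem ncard_setOf_and_fixed_eq_of_semiconj (τ α β : G ≃g G) (hconj : ∀ x, τ (α x) = β (τ x)) (P Q : V → Prop) (hPQ : ∀ x, Q (τ x) ↔ P x) :
    {y | Q y ∧ β y = y}.ncard = {x | P x ∧ α x = x}.ncard := by
  have e1 : {y | Q y ∧ β y = y} = {y | β y = y ∧ Q y} := by ext y; exact and_comm
  have e2 : {x | P x ∧ α x = x} = {x | α x = x ∧ P x} := by ext x; exact and_comm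
  rw [e1, e2, ncard_setOf_fixed_and_eq_of_semiconj τ α β hconj P Q hPQ]

end Reindex

/-! ## §2 The hermitian-plane transports along `τ` -/

section Transport

variable {E : Type*} [Field E] [ValuativeRel E] (σ : E →+* E) {ϖ : E} (H : Matrix (Fin 2) (Fin 2) E)

/-- **`#{x self-dual : d(x, γ′x) = n} = #{x ϖ-modular : d(x, γx) = n}`** for `↑γ′ = g↑γg⁻¹`, `g` a scaling similitude (★ engine + §1). The set-builders are those of
★ H2-NUMBERS' `S_k` (`IsSelfDualLattice … x.1 ∧ dist x (γ x) = 2 * k`) at `n := 2 * k`. [cite: LabesseLanglands1979, §§2–3] [cite: Serre1980Trees, II.1.1] -/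
theorem ncard_selfDual_dist_conj_eq_ncard_modular_dist (hϖ : ϖ ≠ 0) (hσϖ : σ ϖ = ϖ)
    (hdisj : ∀ M : Submodule 𝒪[E] (Fin 2 → E), IsSelfDualLattice σ H M → IsModularLattice σ ϖ H M → False)
    (g : GL (Fin 2) E) (hg : formCongr σ g H = ϖ • H) (γ γ' : unitaryGroupOfForm σ H) (hγ' : (γ' : GL (Fin 2) E) = g * (γ : GL (Fin 2) E) * g⁻¹) (n : ℕ) :
    {x : {M : Submodule 𝒪[E] (Fin 2 → E) // IsSpecialLattice σ ϖ H M} |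
        IsSelfDualLattice σ H x.1 ∧ (latticeTree σ ϖ H).dist x (latticeTreeIso σ ϖ H γ' x) = n}.ncard =
      {x : {M : Submodule 𝒪[E] (Fin 2 → E) // IsSpecialLattice σ ϖ H M} |
        IsModularLattice σ ϖ H x.1 ∧ (latticeTree σ ϖ H).dist x (latticeTreeIso σ ϖ H γ x) = n}.ncard := by
  obtain ⟨τ, hsd, -, -, -, hconj⟩ := exists_typeSwap_latticeTreeIso σ H hϖ hσϖ hdisj g hg
  exact ncard_setOf_and_dist_eq_of_semiconj τ (latticeTreeIso σ ϖ H γ) (latticeTreeIso σ ϖ H γ') (hconj γ γ' hγ')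
    (fun x => IsModularLattice σ ϖ H x.1) (fun x => IsSelfDualLattice σ H x.1) hsd n

/-- **`#{x ϖ-modular : d(x, γ′x) = n} = #{x self-dual : d(x, γx) = n}`** (the twin). [cite: LabesseLanglands1979, §§2–3] [cite: Serre1980Trees, II.1.1] -/
theorem ncard_modular_dist_conj_eq_ncard_selfDual_dist (hϖ : ϖ ≠ 0) (hσϖ : σ ϖ = ϖ)
    (hdisj : ∀ M : Submodule 𝒪[E] (Fin 2 → E), IsSelfDualLattice σ H M → IsModularLattice σ ϖ H M → False)
    (g : GL (Fin 2) E) (hg : formCongr σ g H = ϖ • H) (γ γ' : unitaryGroupOfForm σ H) (hγ' : (γ' : GL (Fin 2) E) = g * (γ : GL (Fin 2) E) * g⁻¹) (n : ℕ) :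
    {x : {M : Submodule 𝒪[E] (Fin 2 → E) // IsSpecialLattice σ ϖ H M} |
        IsModularLattice σ ϖ H x.1 ∧ (latticeTree σ ϖ H).dist x (latticeTreeIso σ ϖ H γ' x) = n}.ncard =
      {x : {M : Submodule 𝒪[E] (Fin 2 → E) // IsSpecialLattice σ ϖ H M} |
        IsSelfDualLattice σ H x.1 ∧ (latticeTree σ ϖ H).dist x (latticeTreeIso σ ϖ H γ x) = n}.ncard := by
  obtain ⟨τ, -, hmd, -, -, hconj⟩ := exists_typeSwap_latticeTreeIso σ H hϖ hσϖ hdisj g hg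
  exact ncard_setOf_and_dist_eq_of_semiconj τ (latticeTreeIso σ ϖ H γ) (latticeTreeIso σ ϖ H γ') (hconj γ γ' hγ')
    (fun x => IsSelfDualLattice σ H x.1) (fun x => IsModularLattice σ ϖ H x.1) hmd n

/-- **`#{x self-dual : γ′x = x} = #{x ϖ-modular : γx = x}`** (fixed-point currency; ★ H2-NUMBERS' `F₀` set-builder on the left). [cite: LabesseLanglands1979, §§2–3] -/
theorem ncard_selfDual_fixed_conj_eq_ncard_modular_fixed (hϖ : ϖ ≠ 0) (hσϖ : σ ϖ = ϖ)
    (hdisj : ∀ M : Submodule 𝒪[E] (Fin 2 → E), IsSelfDualLattice σ H M → IsModularLattice σ ϖ H M → False)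
    (g : GL (Fin 2) E) (hg : formCongr σ g H = ϖ • H) (γ γ' : unitaryGroupOfForm σ H) (hγ' : (γ' : GL (Fin 2) E) = g * (γ : GL (Fin 2) E) * g⁻¹) :
    {x : {M : Submodule 𝒪[E] (Fin 2 → E) // IsSpecialLattice σ ϖ H M} |
        IsSelfDualLattice σ H x.1 ∧ latticeTreeIso σ ϖ H γ' x = x}.ncard =
      {x : {M : Submodule 𝒪[E] (Fin 2 → E) // IsSpecialLattice σ ϖ H M} |
        IsModularLattice σ ϖ H x.1 ∧ latticeTreeIso σ ϖ H γ x = x}.ncard := by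
  obtain ⟨τ, hsd, -, -, -, hconj⟩ := exists_typeSwap_latticeTreeIso σ H hϖ hσϖ hdisj g hg
  exact ncard_setOf_and_fixed_eq_of_semiconj τ (latticeTreeIso σ ϖ H γ) (latticeTreeIso σ ϖ H γ') (hconj γ γ' hγ')
    (fun x => IsModularLattice σ ϖ H x.1) (fun x => IsSelfDualLattice σ H x.1) hsd

/-- **`#{x ϖ-modular : γ′x = x} = #{x self-dual : γx = x}`** (the twin). [cite: LabesseLanglands1979, §§2–3] -/
theorem ncard_modular_fixed_conj_eq_ncard_selfDual_fixed (hϖ : ϖ ≠ 0) (hσϖ : σ ϖ = ϖ)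
    (hdisj : ∀ M : Submodule 𝒪[E] (Fin 2 → E), IsSelfDualLattice σ H M → IsModularLattice σ ϖ H M → False)
    (g : GL (Fin 2) E) (hg : formCongr σ g H = ϖ • H) (γ γ' : unitaryGroupOfForm σ H) (hγ' : (γ' : GL (Fin 2) E) = g * (γ : GL (Fin 2) E) * g⁻¹) :
    {x : {M : Submodule 𝒪[E] (Fin 2 → E) // IsSpecialLattice σ ϖ H M} |
        IsModularLattice σ ϖ H x.1 ∧ latticeTreeIso σ ϖ H γ' x = x}.ncard =
      {x : {M : Submodule 𝒪[E] (Fin 2 → E) // IsSpecialLattice σ ϖ H M} |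
        IsSelfDualLattice σ H x.1 ∧ latticeTreeIso σ ϖ H γ x = x}.ncard := by
  obtain ⟨τ, -, hmd, -, -, hconj⟩ := exists_typeSwap_latticeTreeIso σ H hϖ hσϖ hdisj g hg
  exact ncard_setOf_and_fixed_eq_of_semiconj τ (latticeTreeIso σ ϖ H γ) (latticeTreeIso σ ϖ H γ') (hconj γ γ' hγ')
    (fun x => IsSelfDualLattice σ H x.1) (fun x => IsModularLattice σ ϖ H x.1) hmd

/-- THE TYPE FUNCTION SWAPS ALONG `τ`: for `c` with `c x = 0 ↔ x` self-dual and `i ≠ j` in `Fin 2`, `c (τ x) = i ↔ c x = j` whenever `τ x` is self-dual iff `x` is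
`ϖ`-modular. [cite: BruhatTits1972, §10] -/
theorem typeFun_swap_iff_of_swap
    (hdisj : ∀ M : Submodule 𝒪[E] (Fin 2 → E), IsSelfDualLattice σ H M → IsModularLattice σ ϖ H M → False)
    (τ : latticeTree σ ϖ H ≃g latticeTree σ ϖ H)
    (hsd : ∀ x, IsSelfDualLattice σ H (τ x).1 ↔ IsModularLattice σ ϖ H x.1)
    (c : {M : Submodule 𝒪[E] (Fin 2 → E) // IsSpecialLattice σ ϖ H M} → Fin 2) (hc0 : ∀ v, c v = 0 ↔ IsSelfDualLattice σ H v.1)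
    {i j : Fin 2} (hij : i ≠ j) (x : {M : Submodule 𝒪[E] (Fin 2 → E) // IsSpecialLattice σ ϖ H M}) :
    c (τ x) = i ↔ c x = j := by
  have hmod_iff : ∀ y : {M : Submodule 𝒪[E] (Fin 2 → E) // IsSpecialLattice σ ϖ H M},
      IsModularLattice σ ϖ H y.1 ↔ ¬ IsSelfDualLattice σ H y.1 :=
    fun y => ⟨fun hm hs => hdisj _ hs hm, fun hs => y.2.resolve_left hs⟩
  have h0 : c (τ x) = 0 ↔ ¬ c x = 0 := by rw [hc0, hc0, hsd, hmod_iff]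
  have h1 : ∀ t : Fin 2, t = 1 ↔ ¬ t = 0 := by decide
  have h01 : ∀ t : Fin 2, t = 0 ∨ t = 1 := by decide
  rcases h01 i with rfl | rfl <;> rcases h01 j with rfl | rfl
  · exact absurd rfl hij
  · rw [h0, h1]
  · rw [h1, h0, not_not]
  · exact absurd rfl hij

/-- **TYPE-FUNCTION CURRENCY: `#{x : d(x, γ′x) = n ∧ c x = i} = #{x : d(x, γx) = n ∧ c x = j}` (`i ≠ j`)** — the set-builders of ★ H2-NUMBERS' `N_i` ∕ ★ W8-f;
p02's `hswap : S₀(δ′,k) = S₁(δ,k)` is `(i, j) = (0, 1)`, `n := 2 * k`. [cite: LabesseLanglands1979, §§2–3] [cite: Rogawski1990, §4.9 Lemma 4.9.3] -/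
theorem ncard_dist_conj_typeFun_eq_ncard_dist_typeFun (hϖ : ϖ ≠ 0) (hσϖ : σ ϖ = ϖ)
    (hdisj : ∀ M : Submodule 𝒪[E] (Fin 2 → E), IsSelfDualLattice σ H M → IsModularLattice σ ϖ H M → False)
    (g : GL (Fin 2) E) (hg : formCongr σ g H = ϖ • H) (γ γ' : unitaryGroupOfForm σ H) (hγ' : (γ' : GL (Fin 2) E) = g * (γ : GL (Fin 2) E) * g⁻¹)
    (c : {M : Submodule 𝒪[E] (Fin 2 → E) // IsSpecialLattice σ ϖ H M} → Fin 2) (hc0 : ∀ v, c v = 0 ↔ IsSelfDualLattice σ H v.1)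
    {i j : Fin 2} (hij : i ≠ j) (n : ℕ) :
    {x : {M : Submodule 𝒪[E] (Fin 2 → E) // IsSpecialLattice σ ϖ H M} |
        (latticeTree σ ϖ H).dist x (latticeTreeIso σ ϖ H γ' x) = n ∧ c x = i}.ncard =
      {x : {M : Submodule 𝒪[E] (Fin 2 → E) // IsSpecialLattice σ ϖ H M} |
        (latticeTree σ ϖ H).dist x (latticeTreeIso σ ϖ H γ x) = n ∧ c x = j}.ncard := by
  obtain ⟨τ, hsd, -, -, -, hconj⟩ := exists_typeSwap_latticeTreeIso σ H hϖ hσϖ hdisj g hg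
  exact ncard_setOf_dist_and_eq_of_semiconj τ (latticeTreeIso σ ϖ H γ) (latticeTreeIso σ ϖ H γ') (hconj γ γ' hγ')
    (fun x => c x = j) (fun x => c x = i) (fun x => typeFun_swap_iff_of_swap σ H hdisj τ hsd c hc0 hij x) n

/-- **TYPE-FUNCTION CURRENCY, fixed points: `#{x : γ′x = x ∧ c x = i} = #{x : γx = x ∧ c x = j}` (`i ≠ j`).** [cite: LabesseLanglands1979, §§2–3] -/
theorem ncard_fixed_conj_typeFun_eq_ncard_fixed_typeFun (hϖ : ϖ ≠ 0) (hσϖ : σ ϖ = ϖ)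
    (hdisj : ∀ M : Submodule 𝒪[E] (Fin 2 → E), IsSelfDualLattice σ H M → IsModularLattice σ ϖ H M → False)
    (g : GL (Fin 2) E) (hg : formCongr σ g H = ϖ • H) (γ γ' : unitaryGroupOfForm σ H) (hγ' : (γ' : GL (Fin 2) E) = g * (γ : GL (Fin 2) E) * g⁻¹)
    (c : {M : Submodule 𝒪[E] (Fin 2 → E) // IsSpecialLattice σ ϖ H M} → Fin 2) (hc0 : ∀ v, c v = 0 ↔ IsSelfDualLattice σ H v.1)
    {i j : Fin 2} (hij : i ≠ j) :
    {x : {M : Submodule 𝒪[E] (Fin 2 → E) // IsSpecialLattice σ ϖ H M} | latticeTreeIso σ ϖ H γ' x = x ∧ c x = i}.ncard =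
      {x : {M : Submodule 𝒪[E] (Fin 2 → E) // IsSpecialLattice σ ϖ H M} | latticeTreeIso σ ϖ H γ x = x ∧ c x = j}.ncard := by
  obtain ⟨τ, hsd, -, -, -, hconj⟩ := exists_typeSwap_latticeTreeIso σ H hϖ hσϖ hdisj g hg
  exact ncard_setOf_fixed_and_eq_of_semiconj τ (latticeTreeIso σ ϖ H γ) (latticeTreeIso σ ϖ H γ') (hconj γ γ' hγ')
    (fun x => c x = j) (fun x => c x = i) (fun x => typeFun_swap_iff_of_swap σ H hdisj τ hsd c hc0 hij x)

end Transport

/-! ## §3 The `U(1,1)` datum edition: `H = J₂`, `g = diag(ϖ,1) = zpowDiagGL ![1, 0]`, every letter discharged -/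

section Datum

variable {K : Type} [Field K] [Valued K (WithZero (Multiplicative ℤ))] [ValuativeRel K]
  [(Valued.v : Valuation K (WithZero (Multiplicative ℤ))).Compatible] {σ : K →+* K} {ϖ : K}
  (hd : HermitianLattice.UnramifiedLocalConjDatum σ ϖ)
  (γ γ' : unitaryGroupOfForm σ ((StdForm.antidiagonal 2).over K))
  (hγ' : (γ' : GL (Fin 2) K) = zpowDiagGL (CartanUnique.uniformizer_ne_zero hd.vϖ) ![(1 : ℤ), 0] * (γ : GL (Fin 2) K) *
    (zpowDiagGL (CartanUnique.uniformizer_ne_zero hd.vϖ) ![(1 : ℤ), 0])⁻¹)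
include hγ'

/-- **AT A DATUM: `#{x self-dual : d(x, γ′x) = n} = #{x ϖ-modular : d(x, γx) = n}`** for `↑γ′ = diag(ϖ,1)·↑γ·diag(ϖ,1)⁻¹` (★ H2-NUMBERS' `S_k` set-builder at `n := 2*k`).
[cite: LabesseLanglands1979, §§2–3] [cite: Rogawski1990, §4.9 Lemma 4.9.3] -/
theorem ncard_selfDual_dist_conj_eq_ncard_modular_dist_of_datum (n : ℕ) :
    {x : {M : Submodule 𝒪[K] (Fin 2 → K) // IsSpecialLattice σ ϖ ((StdForm.antidiagonal 2).over K) M} |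
        IsSelfDualLattice σ ((StdForm.antidiagonal 2).over K) x.1 ∧
          (latticeTree σ ϖ ((StdForm.antidiagonal 2).over K)).dist x (latticeTreeIso σ ϖ ((StdForm.antidiagonal 2).over K) γ' x) = n}.ncard =
      {x : {M : Submodule 𝒪[K] (Fin 2 → K) // IsSpecialLattice σ ϖ ((StdForm.antidiagonal 2).over K) M} |
        IsModularLattice σ ϖ ((StdForm.antidiagonal 2).over K) x.1 ∧
          (latticeTree σ ϖ ((StdForm.antidiagonal 2).over K)).dist x (latticeTreeIso σ ϖ ((StdForm.antidiagonal 2).over K) γ x) = n}.ncard :=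
  ncard_selfDual_dist_conj_eq_ncard_modular_dist σ _ (CartanUnique.uniformizer_ne_zero hd.vϖ) hd.σϖ
    (fun M h1 h2 => not_isModularLattice_of_isSelfDualLattice_of_datum hd _ M h1 h2) _ (formCongr_zpowDiagGL_one_zero_antidiagonal_two hd) γ γ' hγ' n

/-- **AT A DATUM: `#{x ϖ-modular : d(x, γ′x) = n} = #{x self-dual : d(x, γx) = n}`.** [cite: LabesseLanglands1979, §§2–3] [cite: Rogawski1990, §4.9 Lemma 4.9.3] -/
theorem ncard_modular_dist_conj_eq_ncard_selfDual_dist_of_datum (n : ℕ) :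
    {x : {M : Submodule 𝒪[K] (Fin 2 → K) // IsSpecialLattice σ ϖ ((StdForm.antidiagonal 2).over K) M} |
        IsModularLattice σ ϖ ((StdForm.antidiagonal 2).over K) x.1 ∧
          (latticeTree σ ϖ ((StdForm.antidiagonal 2).over K)).dist x (latticeTreeIso σ ϖ ((StdForm.antidiagonal 2).over K) γ' x) = n}.ncard =
      {x : {M : Submodule 𝒪[K] (Fin 2 → K) // IsSpecialLattice σ ϖ ((StdForm.antidiagonal 2).over K) M} |
        IsSelfDualLattice σ ((StdForm.antidiagonal 2).over K) x.1 ∧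
          (latticeTree σ ϖ ((StdForm.antidiagonal 2).over K)).dist x (latticeTreeIso σ ϖ ((StdForm.antidiagonal 2).over K) γ x) = n}.ncard :=
  ncard_modular_dist_conj_eq_ncard_selfDual_dist σ _ (CartanUnique.uniformizer_ne_zero hd.vϖ) hd.σϖ
    (fun M h1 h2 => not_isModularLattice_of_isSelfDualLattice_of_datum hd _ M h1 h2) _ (formCongr_zpowDiagGL_one_zero_antidiagonal_two hd) γ γ' hγ' n

/-- **AT A DATUM, FIXED POINTS: `#{x self-dual : γ′x = x} = #{x ϖ-modular : γx = x}`** (★ H2-NUMBERS' `F₀` set-builder on the left: HF1.2's `F₀(δ_ϖ)`).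
[cite: LabesseLanglands1979, §§2–3] [cite: Rogawski1990, §4.9 Lemma 4.9.3] -/
theorem ncard_selfDual_fixed_conj_eq_ncard_modular_fixed_of_datum :
    {x : {M : Submodule 𝒪[K] (Fin 2 → K) // IsSpecialLattice σ ϖ ((StdForm.antidiagonal 2).over K) M} |
        IsSelfDualLattice σ ((StdForm.antidiagonal 2).over K) x.1 ∧ latticeTreeIso σ ϖ ((StdForm.antidiagonal 2).over K) γ' x = x}.ncard =
      {x : {M : Submodule 𝒪[K] (Fin 2 → K) // IsSpecialLattice σ ϖ ((StdForm.antidiagonal 2).over K) M} |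
        IsModularLattice σ ϖ ((StdForm.antidiagonal 2).over K) x.1 ∧ latticeTreeIso σ ϖ ((StdForm.antidiagonal 2).over K) γ x = x}.ncard :=
  ncard_selfDual_fixed_conj_eq_ncard_modular_fixed σ _ (CartanUnique.uniformizer_ne_zero hd.vϖ) hd.σϖ
    (fun M h1 h2 => not_isModularLattice_of_isSelfDualLattice_of_datum hd _ M h1 h2) _ (formCongr_zpowDiagGL_one_zero_antidiagonal_two hd) γ γ' hγ'

/-- **AT A DATUM, FIXED POINTS: `#{x ϖ-modular : γ′x = x} = #{x self-dual : γx = x}`.** [cite: LabesseLanglands1979, §§2–3] [cite: Rogawski1990, §4.9 Lemma 4.9.3] -/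
theorem ncard_modular_fixed_conj_eq_ncard_selfDual_fixed_of_datum :
    {x : {M : Submodule 𝒪[K] (Fin 2 → K) // IsSpecialLattice σ ϖ ((StdForm.antidiagonal 2).over K) M} |
        IsModularLattice σ ϖ ((StdForm.antidiagonal 2).over K) x.1 ∧ latticeTreeIso σ ϖ ((StdForm.antidiagonal 2).over K) γ' x = x}.ncard =
      {x : {M : Submodule 𝒪[K] (Fin 2 → K) // IsSpecialLattice σ ϖ ((StdForm.antidiagonal 2).over K) M} |
        IsSelfDualLattice σ ((StdForm.antidiagonal 2).over K) x.1 ∧ latticeTreeIso σ ϖ ((StdForm.antidiagonal 2).over K) γ x = x}.ncard :=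
  ncard_modular_fixed_conj_eq_ncard_selfDual_fixed σ _ (CartanUnique.uniformizer_ne_zero hd.vϖ) hd.σϖ
    (fun M h1 h2 => not_isModularLattice_of_isSelfDualLattice_of_datum hd _ M h1 h2) _ (formCongr_zpowDiagGL_one_zero_antidiagonal_two hd) γ γ'  hγ'

/-- **AT A DATUM, TYPE-FUNCTION CURRENCY: `#{x : d(x, γ′x) = n ∧ c x = i} = #{x : d(x, γx) = n ∧ c x = j}` (`i ≠ j`)** — at `n := 2`: HF1.2's `N₀(δ_ϖ) = N₁(δ₁)`,
`N₁(δ_ϖ) = N₀(δ₁)`; at `n := 2*k`, `(i,j) = (0,1)`: p02's `hswap`. [cite: LabesseLanglands1979, §§2–3] [cite: Rogawski1990, §4.9 Lemma 4.9.3] -/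
theorem ncard_dist_conj_typeFun_eq_ncard_dist_typeFun_of_datum
    (c : {M : Submodule 𝒪[K] (Fin 2 → K) // IsSpecialLattice σ ϖ ((StdForm.antidiagonal 2).over K) M} → Fin 2)
    (hc0 : ∀ v, c v = 0 ↔ IsSelfDualLattice σ ((StdForm.antidiagonal 2).over K) v.1) {i j : Fin 2} (hij : i ≠ j) (n : ℕ) :
    {x : {M : Submodule 𝒪[K] (Fin 2 → K) // IsSpecialLattice σ ϖ ((StdForm.antidiagonal 2).over K) M} |
        (latticeTree σ ϖ ((StdForm.antidiagonal 2).over K)).dist x (latticeTreeIso σ ϖ ((StdForm.antidiagonal 2).over K) γ' x) = n ∧ c x = i}.ncard =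
      {x : {M : Submodule 𝒪[K] (Fin 2 → K) // IsSpecialLattice σ ϖ ((StdForm.antidiagonal 2).over K) M} |
        (latticeTree σ ϖ ((StdForm.antidiagonal 2).over K)).dist x (latticeTreeIso σ ϖ ((StdForm.antidiagonal 2).over K) γ x) = n ∧ c x = j}.ncard :=
  ncard_dist_conj_typeFun_eq_ncard_dist_typeFun σ _ (CartanUnique.uniformizer_ne_zero hd.vϖ) hd.σϖ
    (fun M h1 h2 => not_isModularLattice_of_isSelfDualLattice_of_datum hd _ M h1 h2) _ (formCongr_zpowDiagGL_one_zero_antidiagonal_two hd) γ γ' hγ' c hc0 hij n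

/-- **AT A DATUM, TYPE-FUNCTION CURRENCY, FIXED POINTS: `#{x : γ′x = x ∧ c x = i} = #{x : γx = x ∧ c x = j}` (`i ≠ j`).** [cite: LabesseLanglands1979, §§2–3] -/
theorem ncard_fixed_conj_typeFun_eq_ncard_fixed_typeFun_of_datum
    (c : {M : Submodule 𝒪[K] (Fin 2 → K) // IsSpecialLattice σ ϖ ((StdForm.antidiagonal 2).over K) M} → Fin 2)
    (hc0 : ∀ v, c v = 0 ↔ IsSelfDualLattice σ ((StdForm.antidiagonal 2).over K) v.1) {i j : Fin 2} (hij : i ≠ j) :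
    {x : {M : Submodule 𝒪[K] (Fin 2 → K) // IsSpecialLattice σ ϖ ((StdForm.antidiagonal 2).over K) M} |
        latticeTreeIso σ ϖ ((StdForm.antidiagonal 2).over K) γ' x = x ∧ c x = i}.ncard =
      {x : {M : Submodule 𝒪[K] (Fin 2 → K) // IsSpecialLattice σ ϖ ((StdForm.antidiagonal 2).over K) M} |
        latticeTreeIso σ ϖ ((StdForm.antidiagonal 2).over K) γ x = x ∧ c x = j}.ncard :=
  ncard_fixed_conj_typeFun_eq_ncard_fixed_typeFun σ _ (CartanUnique.uniformizer_ne_zero hd.vϖ) hd.σϖ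
    (fun M h1 h2 => not_isModularLattice_of_isSelfDualLattice_of_datum hd _ M h1 h2) _ (formCongr_zpowDiagGL_one_zero_antidiagonal_two hd) γ γ' hγ' c hc0 hij

end Datum

end Summit.HodgeConjecture.HodgeConjecture.R90.S6

end
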